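import Summits.ValiantsHypothesis.ValiantsHypothesis.Theorems.MonotoneRestorationOrbitCompressionQPOrbitSupport
import Summits.ValiantsHypothesis.ValiantsHypothesis.Theorems.MonotoneRestorationOrbitRestorationQPValueOrbitClosure
import Literature.Computability.AlgebraicComplexity.SymmetricOrbitCircuitEval
import HarnessLib

/-!
# Route MonotoneRestoration — aside `OrbitCompressionQP` (stmt-ValiantsHypothesis-18332): the aside in
# VALUE-ORBIT and in EVEN-SUPPORT currency

`OrbitCompressionQP`: a matrix-symmetric `VP` family over `ℂ` with square-symmetric circuits of
quasi-polynomial ORBIT size has square-symmetric circuits of quasi-polynomial SIZE.  Symmetric circuits can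
be removed from the HYPOTHESIS (they stay in the conclusion):

* `orbitCompressionQP_iff_valueOrbitForm` — **the aside is equivalent to its value-orbit form**: every
  matrix-symmetric `VP` family having, for one `c` and every `n`, SOME value derivation of `f n` (an
  ordinary straight-line computation of any length: weighted sums of any fan-in, binary products) all of
  whose VALUES have diagonal `Sym_n`-orbits `≤ 2^{(log₂ n + c)^c}`, has square-symmetric circuits of
  quasi-polynomial size (18293's `ValueOrbit.qpOrbit_of_valueDerivation` /
  `exists_valueDerivation_of_qpOrbitRestorable`);
* `ncard_orbit_le_of_evenSupport` — a value fixed by all EVEN permutations fixing a set `X` pointwise has at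
  most `2 · n^{|X|}` diagonal translates; `qpOrbit_of_evenSupportedDerivation` — so an even-supported
  derivation (supports `≤ (log₂ n + c)^c`) of a diagonally invariant `f` gives a square-symmetric circuit of
  quasi-polynomial orbit size;
* `orbitCompressionQP_iff_evenSupportForm` — **the aside is equivalent to its even-support form**: every
  matrix-symmetric `VP` family having, for one `c`, from some `n₀` on, a value derivation of `f n` every
  value of which is fixed by all even permutations fixing pointwise some `≤ (log₂ n + c)^c` indices, has
  square-symmetric circuits of quasi-polynomial size (`⇐` by the orbit-form support theorem
  `OrbitSupport.evenSupportedDerivation_of_qpOrbit`; `⇒` by the previous bullet, small `n` being absorbed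
  in the constant through the orbit circuit `OrbitCircuit.exists_symmetric_circuit_of_invariant`).

So the open content of the aside is: COMPRESS an even-polylog-supported computation of ANY length of a
matrix-symmetric `VP` polynomial into a square-symmetric circuit of quasi-polynomial size.  Helper file
(`--supports stmt-ValiantsHypothesis-18332`); def-free; nothing here is a named fact; the aside stays open.
-/

noncomputable section

open scoped Classical

-- `Summit.ValiantsHypothesis.ValiantsHypothesis.…` is the tree's single-conjunct layout (Sub = Summit).
set_option linter.dupNamespace false

namespace Summit.ValiantsHypothesis.ValiantsHypothesis.Theorems

namespace OrbitCompressionForms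

open Literature.Computability.AlgebraicComplexity MvPolynomial OrbitRestorationQPDepthThreeRung

/-! ### Value-orbit form -/

/-- **`OrbitCompressionQP` IS EQUIVALENT TO ITS VALUE-ORBIT FORM.** [folklore] -/
theorem orbitCompressionQP_iff_valueOrbitForm :
    Theses.MonotoneRestoration.OrbitCompressionQP ↔
    ∀ f : (n : ℕ) → MvPolynomial (Fin n × Fin n) ℂ,
      (∀ (n : ℕ) (σ τ : Equiv.Perm (Fin n)),
        MvPolynomial.rename (fun p : Fin n × Fin n => (σ p.1, τ p.2)) (f n) = f n) →
      IsVPFamily f →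
      (∃ c : ℕ, ∀ n : ℕ, ∃ 𝒟 : ValueDerivation ℂ (Fin n × Fin n), f n ∈ 𝒟.S ∧
        ∀ q ∈ 𝒟.S, (Set.range fun σ : Equiv.Perm (Fin n) => ren σ q).ncard ≤
          2 ^ ((Nat.log 2 n + c) ^ c)) →
      ∃ c : ℕ, ∀ n : ℕ, ∃ (G : Type) (_ : Fintype G)
        (C : LabelledArithCircuit ℂ (Fin n × Fin n) Unit G),
        C.IsSymmetric (Equiv.Perm (Fin n)) ∧ C.eval (C.output ()) = f n ∧
          Fintype.card G ≤ 2 ^ ((Nat.log 2 n + c) ^ c) := by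
  constructor
  · rintro h f hsymm hVP ⟨c, hc⟩
    refine h f hsymm hVP ⟨c + 3, fun n => ?_⟩
    obtain ⟨𝒟, hf, hS⟩ := hc n
    exact ValueOrbit.qpOrbit_of_valueDerivation 𝒟 hf (ValueOrbit.ren_eq_of_matrixSymmetric (hsymm n)) hS
  · rintro h f hsymm hVP ⟨c, hc⟩
    refine h f hsymm hVP ⟨c, fun n => ?_⟩
    have hp : QPOrbitRestorable c n (f n) := hc n
    obtain ⟨-, 𝒟, hf, hS⟩ := ValueOrbit.exists_valueDerivation_of_qpOrbitRestorable hp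
    exact ⟨𝒟, hf, hS⟩

/-! ### Even supports bound orbits -/

/-- **A value with an even support `X` has at most `2 · n^{|X|}` diagonal translates**: `ren σ q` depends
only on the restriction of `σ` to `X` and the sign of `σ`. [cite: DawarWilsenach2025, §6 (Def. 6.1)] -/
theorem ncard_orbit_le_of_evenSupport {n : ℕ} {q : MvPolynomial (Fin n × Fin n) ℂ} {X : Finset (Fin n)}
    (hX : ∀ ρ : Equiv.Perm (Fin n), (∀ x ∈ X, ρ x = x) → Equiv.Perm.sign ρ = 1 → ren ρ q = q) :
    (Set.range fun σ : Equiv.Perm (Fin n) => ren σ q).ncard ≤ 2 * n ^ X.card := by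
  -- `ren σ q` is determined by `(σ|_X, sign σ)`
  have hagree : ∀ σ τ : Equiv.Perm (Fin n), (∀ x ∈ X, σ x = τ x) →
      Equiv.Perm.sign σ = Equiv.Perm.sign τ → ren σ q = ren τ q := by
    intro σ τ hστ hsign
    have hfix : ren (τ⁻¹ * σ) q = q := by
      refine hX (τ⁻¹ * σ) (fun x hx => ?_) ?_
      · rw [Equiv.Perm.mul_apply, hστ x hx]
        exact τ.symm_apply_apply x
      · rw [map_mul, map_inv, hsign, inv_mul_cancel]
    have := congrArg (ren τ) hfix
    rwa [← ren_mul, mul_inv_cancel_left] at this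
  let key : Equiv.Perm (Fin n) → (X → Fin n) × ℤˣ := fun σ => (fun x => σ x, Equiv.Perm.sign σ)
  have hfac : ∀ σ τ, key σ = key τ → ren σ q = ren τ q := by
    intro σ τ h
    have h1 : ∀ x ∈ X, σ x = τ x := fun x hx => congrFun (Prod.ext_iff.1 h).1 ⟨x, hx⟩
    exact hagree σ τ h1 (Prod.ext_iff.1 h).2
  -- so the range is the image of the range of `key` under a function
  have hsub : (Set.range fun σ : Equiv.Perm (Fin n) => ren σ q) ⊆
      (fun y => ren (Classical.epsilon fun σ => key σ = y) q) '' Set.range key := by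
    rintro _ ⟨σ, rfl⟩
    refine ⟨key σ, ⟨σ, rfl⟩, ?_⟩
    have hε : key (Classical.epsilon fun τ => key τ = key σ) = key σ :=
      Classical.epsilon_spec (p := fun τ => key τ = key σ) ⟨σ, rfl⟩
    exact hfac _ _ hε
  refine (Set.ncard_le_ncard hsub (Set.toFinite _)).trans
    ((Set.ncard_image_le (Set.toFinite _)).trans ?_)
  calc (Set.range key).ncard ≤ (Set.univ : Set ((X → Fin n) × ℤˣ)).ncard :=
        Set.ncard_le_ncard (Set.subset_univ _) (Set.toFinite _)
    _ = 2 * n ^ X.card := by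
        rw [Set.ncard_univ, Nat.card_eq_fintype_card, Fintype.card_prod, Fintype.card_fun,
          Fintype.card_fin, Fintype.card_coe, Fintype.card_units_int, mul_comm]

/-- Arithmetic: `2 · n^E ≤ 2^{(log₂ n + c + 2)^{c+2}}` for `E = (log₂ n + c)^c`. [folklore] -/
theorem evenSupport_arith (n c : ℕ) :
    2 * n ^ ((Nat.log 2 n + c) ^ c) ≤ 2 ^ ((Nat.log 2 n + (c + 2)) ^ (c + 2)) := by
  have hlt : n < 2 ^ (Nat.log 2 n + 1) := Nat.lt_pow_succ_log_self Nat.one_lt_two n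
  generalize Nat.log 2 n = L at hlt ⊢
  set A := (L + c) ^ c with hA
  calc 2 * n ^ A ≤ 2 * (2 ^ (L + 1)) ^ A := Nat.mul_le_mul_left 2 (Nat.pow_le_pow_left hlt.le A)
    _ = 2 ^ (1 + (L + 1) * A) := by rw [← pow_mul, pow_add, pow_one]
    _ ≤ 2 ^ ((L + (c + 2)) ^ (c + 2)) := Nat.pow_le_pow_right (by norm_num) ?_
  have h1 : A ≤ (L + (c + 2)) ^ c := Nat.pow_le_pow_left (by omega) c
  have h2 : (L + (c + 2)) ^ (c + 2) = (L + (c + 2)) ^ c * (L + (c + 2)) ^ 2 := pow_add _ _ _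
  rw [h2]
  have h3 : 1 + (L + 1) * A ≤ A * (L + (c + 2)) ^ 2 := by
    have hA1 : 1 ≤ A := by
      rcases Nat.eq_zero_or_pos c with rfl | hc
      · simp [hA]
      · exact Nat.one_le_pow _ _ (by omega)
    have h4 : (L + 2) ^ 2 ≤ (L + (c + 2)) ^ 2 := Nat.pow_le_pow_left (by omega) 2
    have h5 : 1 + (L + 1) * A ≤ A * (L + 2) ^ 2 := by
      have e1 : A * (L + 2) ^ 2 = A * L * L + 4 * (A * L) + 4 * A := by ring
      have e2 : (L + 1) * A = A * L + A := by ring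
      rw [e1, e2]
      have := Nat.zero_le (A * L * L)
      have := Nat.zero_le (A * L)
      omega
    exact h5.trans (Nat.mul_le_mul_left A h4)
  exact h3.trans (Nat.mul_le_mul_right _ h1)

/-- **Even-supported derivations give quasi-polynomial orbits.**  A diagonally invariant `f` with a value
derivation every value of which is fixed by all even permutations fixing pointwise some `≤ (log₂ n + c)^c`
indices has a square-symmetric circuit of orbit size `≤ 2^{(log₂ n + c + 5)^{c+5}}`. [folklore] -/
theorem qpOrbit_of_evenSupportedDerivation {n c : ℕ} (𝒟 : ValueDerivation ℂ (Fin n × Fin n))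
    {f : MvPolynomial (Fin n × Fin n) ℂ} (hf : f ∈ 𝒟.S) (hfix : ∀ σ : Equiv.Perm (Fin n), ren σ f = f)
    (hS : ∀ q ∈ 𝒟.S, ∃ X : Finset (Fin n), X.card ≤ (Nat.log 2 n + c) ^ c ∧
      ∀ ρ : Equiv.Perm (Fin n), (∀ x ∈ X, ρ x = x) → Equiv.Perm.sign ρ = 1 → ren ρ q = q) :
    ∃ (G : Type) (_ : Fintype G) (C : LabelledArithCircuit ℂ (Fin n × Fin n) Unit G),
      C.IsSymmetric (Equiv.Perm (Fin n)) ∧ C.eval (C.output ()) = f ∧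
        C.orbitSize (Equiv.Perm (Fin n)) ≤ 2 ^ ((Nat.log 2 n + (c + 5)) ^ (c + 5)) :=
  ValueOrbit.qpOrbit_of_valueDerivation (c := c + 2) 𝒟 hf hfix fun q hq => by
    obtain ⟨X, hXk, hX⟩ := hS q hq
    rcases Nat.eq_zero_or_pos n with rfl | hn
    · -- no indices: the symmetry group is trivial
      have hq : ∀ σ : Equiv.Perm (Fin 0), ren σ q = q := fun σ => by rw [Subsingleton.elim σ 1, ren_one]
      exact (ValueOrbit.ncard_orbit_of_invariant hq).trans Nat.one_le_two_pow
    · exact (ncard_orbit_le_of_evenSupport hX).trans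
        ((Nat.mul_le_mul_left 2 (Nat.pow_le_pow_right hn hXk)).trans (evenSupport_arith n c))

/-! ### Even-support form -/

/-- Monotonicity of the quasi-polynomial bound in the constant. [folklore] -/
theorem qp_mono {L c c' : ℕ} (h : c ≤ c') : 2 ^ ((L + c) ^ c) ≤ 2 ^ ((L + c') ^ c') := by
  refine Nat.pow_le_pow_right (by norm_num) ?_
  rcases Nat.eq_zero_or_pos c' with rfl | hc'
  · have : c = 0 := by omega
    subst this; exact le_rfl
  · exact (Nat.pow_le_pow_left (by omega) c).trans (Nat.pow_le_pow_right (by omega) h)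

/-- **`OrbitCompressionQP` IS EQUIVALENT TO ITS EVEN-SUPPORT FORM.**  The open content of the aside is to
compress an even-polylog-supported computation (any length) of a matrix-symmetric `VP` polynomial into a
square-symmetric circuit of quasi-polynomial size. [folklore] -/
theorem orbitCompressionQP_iff_evenSupportForm :
    Theses.MonotoneRestoration.OrbitCompressionQP ↔
    ∀ f : (n : ℕ) → MvPolynomial (Fin n × Fin n) ℂ,
      (∀ (n : ℕ) (σ τ : Equiv.Perm (Fin n)),
        MvPolynomial.rename (fun p : Fin n × Fin n => (σ p.1, τ p.2)) (f n) = f n) →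
      IsVPFamily f →
      (∃ c n₀ : ℕ, ∀ n : ℕ, n₀ ≤ n → ∃ 𝒟 : ValueDerivation ℂ (Fin n × Fin n), f n ∈ 𝒟.S ∧
        ∀ q ∈ 𝒟.S, ∃ X : Finset (Fin n), X.card ≤ (Nat.log 2 n + c) ^ c ∧
          ∀ ρ : Equiv.Perm (Fin n), (∀ x ∈ X, ρ x = x) → Equiv.Perm.sign ρ = 1 → ren ρ q = q) →
      ∃ c : ℕ, ∀ n : ℕ, ∃ (G : Type) (_ : Fintype G)
        (C : LabelledArithCircuit ℂ (Fin n × Fin n) Unit G),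
        C.IsSymmetric (Equiv.Perm (Fin n)) ∧ C.eval (C.output ()) = f n ∧
          Fintype.card G ≤ 2 ^ ((Nat.log 2 n + c) ^ c) := by
  constructor
  · rintro h f hsymm hVP ⟨c, n₀, hc⟩
    have hinv : ∀ (n : ℕ) (σ : Equiv.Perm (Fin n)), ren σ (f n) = f n := fun n =>
      ValueOrbit.ren_eq_of_matrixSymmetric (hsymm n)
    -- a symmetric circuit at every `n` (the orbit circuit), to absorb `n < n₀` in the constant
    have hsmall : ∀ n : ℕ, ∃ M : ℕ, ∃ (G : Type) (_ : Fintype G)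
        (C : LabelledArithCircuit ℂ (Fin n × Fin n) Unit G),
        C.IsSymmetric (Equiv.Perm (Fin n)) ∧ C.eval (C.output ()) = f n ∧
          C.orbitSize (Equiv.Perm (Fin n)) ≤ M := by
      intro n
      obtain ⟨G, inst, C, hC, hev, -⟩ := OrbitCircuit.exists_symmetric_circuit_of_invariant (f n) (hinv n)
      exact ⟨C.orbitSize (Equiv.Perm (Fin n)), G, inst, C, hC, hev, le_rfl⟩
    choose M hM using hsmall
    set c' : ℕ := max (c + 5) ((Finset.range n₀).sup M) with hc'
    refine h f hsymm hVP ⟨c', fun n => ?_⟩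
    rcases Nat.lt_or_ge n n₀ with hn | hn
    · obtain ⟨G, inst, C, hC, hev, horb⟩ := hM n
      refine ⟨G, inst, C, hC, hev, horb.trans ?_⟩
      have h1 : M n ≤ c' := (Finset.le_sup (f := M) (Finset.mem_range.2 hn)).trans (le_max_right _ _)
      calc M n ≤ c' := h1
        _ ≤ (Nat.log 2 n + c') ^ c' := by
            rcases Nat.eq_zero_or_pos c' with h0 | h0
            · omega
            · exact (Nat.le_add_left c' _).trans (Nat.le_self_pow h0.ne' _)
        _ ≤ 2 ^ ((Nat.log 2 n + c') ^ c') := (Nat.lt_two_pow_self).le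
    · obtain ⟨𝒟, hf, hS⟩ := hc n hn
      obtain ⟨G, inst, C, hC, hev, horb⟩ := qpOrbit_of_evenSupportedDerivation 𝒟 hf (hinv n) hS
      exact ⟨G, inst, C, hC, hev, horb.trans (qp_mono (le_max_left _ _))⟩
  · rintro h f hsymm hVP ⟨c, hc⟩
    obtain ⟨n₀, hn₀⟩ := OrbitSupport.evenSupportedDerivation_of_qpOrbit.{0, 0} c
    refine h f hsymm hVP ⟨c, n₀, fun n hn => ?_⟩
    obtain ⟨G, inst, C, hC, hev, horb⟩ := hc n
    obtain ⟨𝒟, hout, hX⟩ := hn₀ n hn C hC horb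
    exact ⟨𝒟, hev ▸ hout, hX⟩

end OrbitCompressionForms

end Summit.ValiantsHypothesis.ValiantsHypothesis.Theorems

end
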